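import Summits.Ventures.PercRepro.MSTightBipartitionTwo

/-!
# Lemma A⁺ applied to the trace: a missing twin-free element costs two units of excess

Let `r` be an element of `F` that lies in some member and outside some member, has no twin, and
is such that `{r}` is **not** a difference of `F`. Then the partner family at `r` is empty, the
trace `proj r F = part0 r F ∪ partr r F` carries the up/down bipartition
`(partr r F, part0 r F)` — no member containing `r`, minus `r`, lies inside a member missing `r`
— and this bipartition is twin-free because `r` has no twin. By
`card_diffs_eq_card_diffs_proj_add`, `|F \\ F| = |proj r F \\ proj r F| + |X ∩ Y|`, and the
collisions of the bipartition lie in `X ∩ Y`; so if the trace is tight, Lemma A⁺ gives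
`|F \\ F| ≥ |F| + 2` (`card_add_two_le_card_diffs_of_singleton_notMem`).

This is the tight-trace case of the conjecture (SD) of proofs/MINE1-theoremS.md, Addendum 17
(«a family of excess at most one has every nontrivial twin class among its differences»); the
case of a trace of excess one is open.
-/

namespace PercRepro.MSTight

open Finset
open scoped FinsetFamily symmDiff

variable {α : Type*} [DecidableEq α] [Fintype α]

section Trace

variable {F : Finset (Finset α)} {r : α}

omit [Fintype α] in
/-- If `{r}` is not a difference, the partner family at `r` is empty. -/
theorem partner_eq_empty_of_singleton_notMem (h : ({r} : Finset α) ∉ F \\ F) :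
    partner r F = ∅ := by
  rw [Finset.eq_empty_iff_forall_notMem]
  intro A hA
  obtain ⟨hA0, hAr⟩ := mem_inter.1 hA
  obtain ⟨hAF, hrA⟩ := mem_part0.1 hA0
  obtain ⟨-, hAr'⟩ := mem_partr.1 hAr
  refine h (mem_diffs.2 ⟨insert r A, hAr', A, hAF, ?_⟩)
  ext x
  simp only [mem_sdiff, mem_insert, mem_singleton]
  constructor
  · rintro ⟨rfl | hx, hxA⟩
    · rfl
    · exact absurd hx hxA
  · rintro rfl
    exact ⟨Or.inl rfl, hrA⟩

omit [Fintype α] in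
/-- With an empty partner family the two parts of the projection are disjoint. -/
theorem proj_sdiff_partr_eq_part0 (h : partner r F = ∅) : proj r F \ partr r F = part0 r F := by
  ext A
  rw [proj_eq_union]
  simp only [mem_sdiff, mem_union]
  constructor
  · rintro ⟨hA | hA, hAr⟩
    · exact hA
    · exact absurd hA hAr
  · intro hA
    refine ⟨Or.inl hA, fun hAr => ?_⟩
    have : A ∈ partner r F := mem_inter.2 ⟨hA, hAr⟩
    rw [h] at this
    exact notMem_empty A this

omit [Fintype α] in
/-- The collisions of the trace bipartition `(partr r F, part0 r F)` lie in `X ∩ Y`. -/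
theorem collisions_subset_X_inter_Y (h : partner r F = ∅) :
    (partr r F \\ (proj r F \ partr r F)) ∩
      ((proj r F \ partr r F) \\ proj r F ∪ proj r F \\ partr r F) ⊆
      diffsX r F ∩ diffsY r F := by
  rw [proj_sdiff_partr_eq_part0 h, proj_eq_union, Finset.diffs_union_right,
    Finset.diffs_union_left]
  intro E hE
  obtain ⟨hY, hX⟩ := mem_inter.1 hE
  refine mem_inter.2 ⟨?_, hY⟩
  unfold diffsX
  simp only [mem_union] at hX ⊢
  tauto

/-- **(SD) at a twin-free element with tight trace.** Let `r` be an element of some member and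
outside some member of `F`, with no twin, such that `{r}` is not a difference of `F` and the
projection of `F` along `r` is tight. Then `|F \\ F| ≥ |F| + 2`. -/
theorem card_add_two_le_card_diffs_of_singleton_notMem
    (htw : ∀ b, Twin F r b → b = r) (hin : ∃ t ∈ F, r ∈ t) (hout : ∃ t ∈ F, r ∉ t)
    (hnot : ({r} : Finset α) ∉ F \\ F) (hP : Tight (proj r F)) :
    F.card + 2 ≤ (F \\ F).card := by
  have hK : partner r F = ∅ := partner_eq_empty_of_singleton_notMem hnot
  have hcard : F.card = (proj r F).card := by
    rw [card_eq_card_proj_add_card_partner r F, hK, card_empty, add_zero]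
  have hsub : partr r F ⊆ proj r F := by
    rw [proj_eq_union]
    exact subset_union_right
  have hne₁ : (partr r F).Nonempty := by
    obtain ⟨t, ht, hrt⟩ := hin
    exact ⟨t.erase r, mem_partr.2 ⟨notMem_erase r t, by rwa [insert_erase hrt]⟩⟩
  have hne₀ : (proj r F \ partr r F).Nonempty := by
    obtain ⟨t, ht, hrt⟩ := hout
    rw [proj_sdiff_partr_eq_part0 hK]
    exact ⟨t, mem_part0.2 ⟨ht, hrt⟩⟩
  have hup : ∀ t ∈ partr r F, ∀ s ∈ proj r F, t ⊆ s → s ∈ partr r F := by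
    intro t ht s hs hts
    by_contra hsF
    have hs0 : s ∈ part0 r F := by
      rw [← proj_sdiff_partr_eq_part0 hK]
      exact mem_sdiff.2 ⟨hs, hsF⟩
    obtain ⟨hsF', hrs⟩ := mem_part0.1 hs0
    obtain ⟨hrt, htF⟩ := mem_partr.1 ht
    refine hnot (mem_diffs.2 ⟨insert r t, htF, s, hsF', ?_⟩)
    ext x
    simp only [mem_sdiff, mem_insert, mem_singleton]
    constructor
    · rintro ⟨rfl | hx, hxs⟩
      · rfl
      · exact absurd (hts hx) hxs
    · rintro rfl
      exact ⟨Or.inl rfl, hrs⟩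
  have htf : ∀ a : α, ∃ t ∈ proj r F, ¬ (t ∈ partr r F ↔ a ∈ t) := by
    intro a
    by_contra h
    have hiff : ∀ t ∈ proj r F, t ∈ partr r F ↔ a ∈ t := fun t ht =>
      by_contra fun h' => h ⟨t, ht, h'⟩
    -- `a` is a twin of `r`
    have htwin : Twin F r a := by
      intro u hu
      constructor
      · intro hru
        have h1 : u.erase r ∈ partr r F := mem_partr.2 ⟨notMem_erase r u, by rwa [insert_erase hru]⟩
        have h2 := (hiff _ (hsub h1)).1 h1
        exact mem_of_mem_erase h2
      · intro hau
        by_contra hru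
        have h0 : u ∈ part0 r F := mem_part0.2 ⟨hu, hru⟩
        have h1 : u ∈ proj r F := by
          rw [proj_eq_union]
          exact mem_union.2 (Or.inl h0)
        have h2 : u ∉ partr r F := by
          intro hur
          have : u ∈ partner r F := mem_inter.2 ⟨h0, hur⟩
          rw [hK] at this
          exact notMem_empty u this
        exact h2 ((hiff u h1).2 hau)
    have har : a = r := htw a htwin
    subst har
    -- but members of the projection never contain `a = r`
    obtain ⟨t, ht⟩ := hne₁
    have h1 : a ∈ t := (hiff t (hsub ht)).1 ht
    exact (mem_partr.1 ht).1 h1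
  have h2 := two_le_card_collisions hP hsub hne₁ hne₀ hup htf
  have h3 := card_le_card (collisions_subset_X_inter_Y hK)
  rw [card_diffs_eq_card_diffs_proj_add r F, hP, ← hcard]
  omega

end Trace

end PercRepro.MSTight
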